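import Mathlib.Analysis.Calculus.LocalExtr.Basic
import Mathlib.Analysis.Calculus.Deriv.Pow
import Mathlib.Analysis.Calculus.Deriv.Mul
import Mathlib.Analysis.Calculus.Deriv.Add
import Literature.Computability.AlgebraicComplexity.QuantumFunctionalsKronecker
import Literature.Computability.AlgebraicComplexity.QuantumFunctionalsDirectSumMarginals
import HarnessLib

/-!
# Spectra from semi-invariants: the Ness–Mumford argument for complex 3-tensors

Topic: `Literature/Computability/AlgebraicComplexity`; part of the decomposition of the named fact
`ChristandlVranaZuiddam2023_kronecker` (CVZ Cor. 3.31, multiplicativity of the quantum functional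
`F^θ = quantumFunctional θ`), sub-multiplicativity half (`ChristandlVranaZuiddam2023_kronecker_le`,
`QuantumFunctionalsKroneckerFacts.lean`). In the source that half rests on the equality
`E^θ = E_θ` of the upper (isotypic-projector) and lower (supremum of entropies over the orbit)
quantum functionals (Thm. 3.30), whose non-trivial direction `E^θ ≤ E_θ` is the
entanglement-polytope characterisation Thm. 3.29: *the normalised highest weight of a covariant
that does not vanish on the orbit of `t` is a triple of marginal spectra of a unit vector in the
orbit closure of `t`*. This file PROVES the analytic mechanism behind that statement for
3-tensors, in elementary form (no representation theory is needed to state or prove it):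

* `IsLowerSemiInvariant f l m n` — `f : (ι → κ → μ → ℂ) → ℂ` transforms under the lower-triangular
  Borel subgroup `B⁻ × B⁻ × B⁻` of `GL(ℂ^ι) × GL(ℂ^κ) × GL(ℂ^μ)` by the character
  `(A, B, C) ↦ ∏ A_ii^{lᵢ} ∏ B_jj^{mⱼ} ∏ C_cc^{n_c}` (a highest-weight covariant of weight
  `(l, m, n)`; such `f` is homogeneous of degree `d = |l|`, `apply_smul`).
* `IsLowerSemiInvariant.exists_degeneratesTo_reducedDensity_eq_diagonal` — **Ness–Mumford for
  tensors**: if `f` is continuous, `d > 0` and `f(x) ≠ 0`, there is a unit vector `u` in the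
  orbit closure of `x` (`TensorDegeneratesTo x u`) whose three reduced density matrices are
  `diag(l/d)`, `diag(m/d)`, `diag(n/d)`.
  Proof: `u` maximises `|f|²` on the (compact) unit sphere of the orbit closure
  (`exists_extremal`); homogeneity turns maximality into `|f(g·u)|² ≤ |f(u)|² ‖g·u‖^{2d}` for all
  `g`; testing the one-parameter families `1 + zE_{pq}` (`q ≤ p`) in each factor, on which the
  character is explicit (`weight_ineq₁/₂/₃`), and comparing first-order terms in `z = t` and
  `z = it` (`natCast_eq_mul_of_pow_le_pow_nhds`, Fermat's stationarity) kills the off-diagonal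
  entries of the marginals and pins the diagonal ones (`eq_diagonal_of_weight_ineq`).
* `IsLowerSemiInvariant.weightedEntropy_le_logQuantumFunctional(_of_orbit)` — consequently
  `E_θ(x) ≥ θ₁ H(l/d) + θ₂ H(m/d) + θ₃ H(n/d)` for `θ ≥ 0` whenever `f` does not vanish on the
  orbit of `x` (with CVZ Lemma 3.20, `quantumEntropy_le_logQuantumFunctional_of_degeneratesTo`).
* Tools: linearity of `actTensor` in each slot, the elementary matrices `E_{pq}` acting on one
  slot, `⟨t | E_{pq}·t⟩ = (|t⟩⟨t|ⱼ)_{qp}`, norm expansions (`tensorNormSq_smul` is imported from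
  `QuantumFunctionalsDirectSumMarginals.lean`), invertibility of triangular matrices,
  symmetric functions of the spectrum of a diagonal matrix, `E_θ(g·x) = E_θ(x)`.

What is NOT here: the representation-theoretic input converting "the isotypic projector
`P_λ ⊗ P_μ ⊗ P_ν` does not kill `t^{⊗n}`" into a non-vanishing covariant of weight `(λ, μ, ν)`
(Schur–Weyl duality; the tree's word model `Literature.NumberTheory.DiophantineGeometry.wordRep`),
and the other ingredients of CVZ §3 (Keyl–Werner, Kronecker coefficients).

## Sources

* L. Ness, *A stratification of the null cone via the moment map* (with an appendix by
  D. Mumford), Amer. J. Math. 106 (1984) 1281–1329 — the first-variation computation at a point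
  of maximal `|f|/‖·‖^d`; M. Brion, *Sur l'image de l'application moment*, LNM 1296 (1987).
* M. Christandl, P. Vrana, J. Zuiddam, *Universal points in the asymptotic spectrum of tensors*,
  J. Amer. Math. Soc. 36 (2023) = arXiv:1709.07851v3, §3.4 (entanglement polytope, Thm. 3.29,
  Thm. 3.30, Lemma 3.20). [key `ChristandlVranaZuiddam2023`]
* M. Walter, B. Doran, D. Gross, M. Christandl, *Entanglement polytopes*, Science 340 (2013).

## Design

* The Borel subgroup is the *lower*-triangular one (`Matrix.BlockTriangular · OrderDual.toDual`),
  so that polynomial semi-invariants have weights `(l, m, n) ≥ 0` with the coordinate functions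
  `x ↦ x_{a b c}` of weight `(e_a, e_b, e_c)`; equivalently `f` is a highest-weight vector for the
  action `(g·f)(x) = f(gᵀ·x)` with respect to the upper-triangular Borel subgroups used in
  `Literature.NumberTheory.DiophantineGeometry.highestWeightSpace`. Index types carry
  `[LinearOrder]` only (it provides the `DecidableEq` used by `reducedDensity`/`GL`).
* Only continuity of `f` is assumed (polynomiality is not needed for the argument); the degree is
  `d = ∑ lᵢ`, and `∑ mⱼ = ∑ n_c = d` is a consequence (traces of the marginals), not a hypothesis.
* Derivatives enter only through the one-variable Fermat lemma applied to explicit polynomials in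
  `t`; no differentiability of `f` is used (on the test subgroups the character is explicit).
-/

noncomputable section

open scoped BigOperators Matrix ComplexOrder
open Filter Topology

namespace Literature.Computability.AlgebraicComplexity

/-! ## A one-variable extremality lemma -/

section Analysis

/-- If `(1 + t)^{2n} ≤ (1 + 2at + bt²)^k` for all real `t` near `0` (with equality at `t = 0`), then
the first-order terms agree: `n = k a` (Fermat's theorem on stationary points applied to the
difference, which has a local minimum at `0`). [folklore] -/
theorem natCast_eq_mul_of_pow_le_pow_nhds {a b : ℝ} {k n : ℕ}
    (h : ∀ᶠ t in 𝓝 (0 : ℝ), (1 + t) ^ (2 * n) ≤ (1 + 2 * a * t + b * t ^ 2) ^ k) :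
    (n : ℝ) = k * a := by
  set g : ℝ → ℝ := fun t => (1 + 2 * a * t + b * t ^ 2) ^ k - (1 + t) ^ (2 * n) with hg
  have hmin : IsLocalMin g 0 := by
    refine h.mono fun t ht => ?_
    simp only [hg, mul_zero, add_zero, zero_pow two_ne_zero, one_pow, sub_self, sub_nonneg]
    exact ht
  have hq : HasDerivAt (fun t : ℝ => 1 + 2 * a * t + b * t ^ 2) (2 * a) 0 := by
    have h1 : HasDerivAt (fun t : ℝ => 2 * a * t) (2 * a) 0 := by
      simpa using (hasDerivAt_id (0 : ℝ)).const_mul (2 * a)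
    have h2 : HasDerivAt (fun t : ℝ => b * t ^ 2) 0 0 := by
      simpa using (hasDerivAt_pow 2 (0 : ℝ)).const_mul b
    simpa using (h1.const_add 1).fun_add h2
  have hqk : HasDerivAt (fun t : ℝ => (1 + 2 * a * t + b * t ^ 2) ^ k) (k * (2 * a)) 0 := by
    simpa using hq.fun_pow k
  have hp : HasDerivAt (fun t : ℝ => (1 + t) ^ (2 * n)) ((2 * n : ℕ) : ℝ) 0 := by
    simpa using ((hasDerivAt_id (0 : ℝ)).const_add 1).fun_pow (2 * n)
  have hg' : HasDerivAt g (k * (2 * a) - (2 * n : ℕ)) 0 := hqk.sub hp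
  have h0 := hmin.hasDerivAt_eq_zero hg'
  push_cast at h0
  linarith

end Analysis

/-! ## Linearity of the action in each factor; elementary matrices -/

section ActLinear

variable {K : Type*} [CommRing K] {ι κ μ ι' κ' μ' : Type*} [Fintype ι] [Fintype κ] [Fintype μ]

/-- Additivity of `(A ⊗ B ⊗ C)·t` in `A`. [folklore] -/
theorem actTensor_add_fst (A A' : Matrix ι' ι K) (B : Matrix κ' κ K) (C : Matrix μ' μ K)
    (t : ι → κ → μ → K) : actTensor (A + A') B C t = actTensor A B C t + actTensor A' B C t := by
  funext a b c
  simp only [actTensor_apply, Matrix.add_apply, Pi.add_apply, add_mul, Finset.sum_add_distrib]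

/-- Homogeneity of `(A ⊗ B ⊗ C)·t` in `A`. [folklore] -/
theorem actTensor_smul_fst (z : K) (A : Matrix ι' ι K) (B : Matrix κ' κ K) (C : Matrix μ' μ K)
    (t : ι → κ → μ → K) : actTensor (z • A) B C t = z • actTensor A B C t := by
  funext a b c
  simp only [actTensor_apply, Matrix.smul_apply, Pi.smul_apply, smul_eq_mul, Finset.mul_sum]
  exact Finset.sum_congr rfl fun _ _ => Finset.sum_congr rfl fun _ _ =>
    Finset.sum_congr rfl fun _ _ => by ring

/-- Additivity of `(A ⊗ B ⊗ C)·t` in `B`. [folklore] -/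
theorem actTensor_add_snd (A : Matrix ι' ι K) (B B' : Matrix κ' κ K) (C : Matrix μ' μ K)
    (t : ι → κ → μ → K) : actTensor A (B + B') C t = actTensor A B C t + actTensor A B' C t := by
  funext a b c
  simp only [actTensor_apply, Matrix.add_apply, Pi.add_apply, add_mul, mul_add,
    Finset.sum_add_distrib]

/-- Homogeneity of `(A ⊗ B ⊗ C)·t` in `B`. [folklore] -/
theorem actTensor_smul_snd (z : K) (A : Matrix ι' ι K) (B : Matrix κ' κ K) (C : Matrix μ' μ K)
    (t : ι → κ → μ → K) : actTensor A (z • B) C t = z • actTensor A B C t := by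
  funext a b c
  simp only [actTensor_apply, Matrix.smul_apply, Pi.smul_apply, smul_eq_mul, Finset.mul_sum]
  exact Finset.sum_congr rfl fun _ _ => Finset.sum_congr rfl fun _ _ =>
    Finset.sum_congr rfl fun _ _ => by ring

/-- Additivity of `(A ⊗ B ⊗ C)·t` in `C`. [folklore] -/
theorem actTensor_add_thd (A : Matrix ι' ι K) (B : Matrix κ' κ K) (C C' : Matrix μ' μ K)
    (t : ι → κ → μ → K) : actTensor A B (C + C') t = actTensor A B C t + actTensor A B C' t := by
  funext a b c
  simp only [actTensor_apply, Matrix.add_apply, Pi.add_apply, add_mul, mul_add,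
    Finset.sum_add_distrib]

/-- Homogeneity of `(A ⊗ B ⊗ C)·t` in `C`. [folklore] -/
theorem actTensor_smul_thd (z : K) (A : Matrix ι' ι K) (B : Matrix κ' κ K) (C : Matrix μ' μ K)
    (t : ι → κ → μ → K) : actTensor A B (z • C) t = z • actTensor A B C t := by
  funext a b c
  simp only [actTensor_apply, Matrix.smul_apply, Pi.smul_apply, smul_eq_mul, Finset.mul_sum]
  exact Finset.sum_congr rfl fun _ _ => Finset.sum_congr rfl fun _ _ =>
    Finset.sum_congr rfl fun _ _ => by ring

variable [DecidableEq ι] [DecidableEq κ] [DecidableEq μ]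

omit [DecidableEq ι] in
/-- Action on the first factor only: `((A ⊗ 1 ⊗ 1)·t)_{abc} = ∑_{a'} A_{aa'} t_{a'bc}`.
[folklore] -/
theorem actTensor_fst_apply (A : Matrix ι' ι K) (t : ι → κ → μ → K) (a : ι') (b : κ) (c : μ) :
    actTensor A (1 : Matrix κ κ K) (1 : Matrix μ μ K) t a b c = ∑ a', A a a' * t a' b c := by
  simp [actTensor_apply, Matrix.one_apply]

omit [DecidableEq κ] in
/-- Action on the second factor only: `((1 ⊗ B ⊗ 1)·t)_{abc} = ∑_{b'} B_{bb'} t_{ab'c}`.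
[folklore] -/
theorem actTensor_snd_apply (B : Matrix κ' κ K) (t : ι → κ → μ → K) (a : ι) (b : κ') (c : μ) :
    actTensor (1 : Matrix ι ι K) B (1 : Matrix μ μ K) t a b c = ∑ b', B b b' * t a b' c := by
  simp [actTensor_apply, Matrix.one_apply]

omit [DecidableEq μ] in
/-- Action on the third factor only: `((1 ⊗ 1 ⊗ C)·t)_{abc} = ∑_{c'} C_{cc'} t_{abc'}`.
[folklore] -/
theorem actTensor_thd_apply (C : Matrix μ' μ K) (t : ι → κ → μ → K) (a : ι) (b : κ) (c : μ') :
    actTensor (1 : Matrix ι ι K) (1 : Matrix κ κ K) C t a b c = ∑ c', C c c' * t a b c' := by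
  simp [actTensor_apply, Matrix.one_apply]

/-- The elementary matrix `E_{pq}` acting on the first factor moves the `q`-th slice to position
`p`: `((E_{pq} ⊗ 1 ⊗ 1)·t)_{abc} = [a = p] t_{qbc}`. [folklore] -/
theorem actTensor_single_fst_apply (p q : ι) (t : ι → κ → μ → K) (a : ι) (b : κ) (c : μ) :
    actTensor (Matrix.single p q (1 : K)) (1 : Matrix κ κ K) (1 : Matrix μ μ K) t a b c =
      if p = a then t q b c else 0 := by
  rw [actTensor_fst_apply]
  by_cases h : p = a
  · subst h
    rw [if_pos rfl, Finset.sum_eq_single q, Matrix.single_apply_same, one_mul]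
    · intro x _ hx
      rw [Matrix.single_apply_of_col_ne p p (Ne.symm hx), zero_mul]
    · intro hq
      exact absurd (Finset.mem_univ q) hq
  · simp [h]

/-- `((1 ⊗ E_{pq} ⊗ 1)·t)_{abc} = [b = p] t_{aqc}`. [folklore] -/
theorem actTensor_single_snd_apply (p q : κ) (t : ι → κ → μ → K) (a : ι) (b : κ) (c : μ) :
    actTensor (1 : Matrix ι ι K) (Matrix.single p q (1 : K)) (1 : Matrix μ μ K) t a b c =
      if p = b then t a q c else 0 := by
  rw [actTensor_snd_apply]
  by_cases h : p = b
  · subst h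
    rw [if_pos rfl, Finset.sum_eq_single q, Matrix.single_apply_same, one_mul]
    · intro x _ hx
      rw [Matrix.single_apply_of_col_ne p p (Ne.symm hx), zero_mul]
    · intro hq
      exact absurd (Finset.mem_univ q) hq
  · simp [h]

/-- `((1 ⊗ 1 ⊗ E_{pq})·t)_{abc} = [c = p] t_{abq}`. [folklore] -/
theorem actTensor_single_thd_apply (p q : μ) (t : ι → κ → μ → K) (a : ι) (b : κ) (c : μ) :
    actTensor (1 : Matrix ι ι K) (1 : Matrix κ κ K) (Matrix.single p q (1 : K)) t a b c =
      if p = c then t a b q else 0 := by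
  rw [actTensor_thd_apply]
  by_cases h : p = c
  · subst h
    rw [if_pos rfl, Finset.sum_eq_single q, Matrix.single_apply_same, one_mul]
    · intro x _ hx
      rw [Matrix.single_apply_of_col_ne p p (Ne.symm hx), zero_mul]
    · intro hq
      exact absurd (Finset.mem_univ q) hq
  · simp [h]

/-- `((1 + z E) ⊗ 1 ⊗ 1)·t = t + z • (E ⊗ 1 ⊗ 1)·t`. [folklore] -/
theorem actTensor_one_add_smul_fst (z : K) (E : Matrix ι ι K) (t : ι → κ → μ → K) :
    actTensor (1 + z • E) (1 : Matrix κ κ K) (1 : Matrix μ μ K) t =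
      t + z • actTensor E (1 : Matrix κ κ K) (1 : Matrix μ μ K) t := by
  rw [actTensor_add_fst, actTensor_smul_fst, actTensor_one]

/-- `(1 ⊗ (1 + z E) ⊗ 1)·t = t + z • (1 ⊗ E ⊗ 1)·t`. [folklore] -/
theorem actTensor_one_add_smul_snd (z : K) (E : Matrix κ κ K) (t : ι → κ → μ → K) :
    actTensor (1 : Matrix ι ι K) (1 + z • E) (1 : Matrix μ μ K) t =
      t + z • actTensor (1 : Matrix ι ι K) E (1 : Matrix μ μ K) t := by
  rw [actTensor_add_snd, actTensor_smul_snd, actTensor_one]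

/-- `(1 ⊗ 1 ⊗ (1 + z E))·t = t + z • (1 ⊗ 1 ⊗ E)·t`. [folklore] -/
theorem actTensor_one_add_smul_thd (z : K) (E : Matrix μ μ K) (t : ι → κ → μ → K) :
    actTensor (1 : Matrix ι ι K) (1 : Matrix κ κ K) (1 + z • E) t =
      t + z • actTensor (1 : Matrix ι ι K) (1 : Matrix κ κ K) E t := by
  rw [actTensor_add_thd, actTensor_smul_thd, actTensor_one]

/-- Scalars act by scalar multiplication: `((c·1) ⊗ 1 ⊗ 1)·t = c • t`. [folklore] -/
theorem actTensor_smul_one (c : K) (t : ι → κ → μ → K) :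
    actTensor (c • (1 : Matrix ι ι K)) (1 : Matrix κ κ K) (1 : Matrix μ μ K) t = c • t := by
  rw [actTensor_smul_fst, actTensor_one]

end ActLinear

/-! ## Norm expansions -/

section Norms

variable {ι κ μ : Type*} [Fintype ι] [Fintype κ] [Fintype μ]

/-- `‖z + w‖² = ‖z‖² + 2 Re(z̄ w) + ‖w‖²` for complex numbers. [folklore] -/
theorem norm_add_sq_complex (z w : ℂ) :
    ‖z + w‖ ^ 2 = ‖z‖ ^ 2 + 2 * (star z * w).re + ‖w‖ ^ 2 := by
  rw [← Complex.normSq_eq_norm_sq, ← Complex.normSq_eq_norm_sq, ← Complex.normSq_eq_norm_sq,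
    Complex.normSq_add]
  have : (z * (starRingEnd ℂ) w).re = (star z * w).re := by
    simp only [Complex.mul_re, Complex.conj_re, Complex.conj_im, Complex.star_def]
    ring
  rw [this]
  ring

/-- `⟨t + w | t + w⟩ = ⟨t|t⟩ + 2 Re⟨t|w⟩ + ⟨w|w⟩`. [folklore] -/
theorem tensorNormSq_add (t w : ι → κ → μ → ℂ) :
    tensorNormSq (t + w) =
      tensorNormSq t + 2 * (∑ a, ∑ b, ∑ c, star (t a b c) * w a b c).re + tensorNormSq w := by
  simp only [tensorNormSq, Pi.add_apply, norm_add_sq_complex, Finset.sum_add_distrib,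
    Complex.re_sum, Finset.mul_sum]

/-- `⟨t + z w | t + z w⟩ = ⟨t|t⟩ + 2 Re(z ⟨t|w⟩) + |z|² ⟨w|w⟩`. [folklore] -/
theorem tensorNormSq_add_smul (t w : ι → κ → μ → ℂ) (z : ℂ) :
    tensorNormSq (t + z • w) = tensorNormSq t +
      2 * (z * ∑ a, ∑ b, ∑ c, star (t a b c) * w a b c).re + ‖z‖ ^ 2 * tensorNormSq w := by
  have h : ∑ a, ∑ b, ∑ c, star (t a b c) * (z • w) a b c =
      z * ∑ a, ∑ b, ∑ c, star (t a b c) * w a b c := by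
    simp only [Pi.smul_apply, smul_eq_mul, Finset.mul_sum]
    exact Finset.sum_congr rfl fun _ _ => Finset.sum_congr rfl fun _ _ =>
      Finset.sum_congr rfl fun _ _ => by ring
  rw [tensorNormSq_add, tensorNormSq_smul, h]

/-- A single entry is bounded by the norm: `‖t_{abc}‖² ≤ ⟨t|t⟩`. [folklore] -/
theorem norm_sq_le_tensorNormSq (t : ι → κ → μ → ℂ) (a : ι) (b : κ) (c : μ) :
    ‖t a b c‖ ^ 2 ≤ tensorNormSq t := by
  unfold tensorNormSq
  refine le_trans ?_ (Finset.single_le_sum (fun a' _ => Finset.sum_nonneg fun b' _ =>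
    Finset.sum_nonneg fun c' _ => sq_nonneg ‖t a' b' c'‖) (Finset.mem_univ a))
  refine le_trans ?_ (Finset.single_le_sum (fun b' _ => Finset.sum_nonneg fun c' _ =>
    sq_nonneg ‖t a b' c'‖) (Finset.mem_univ b))
  exact Finset.single_le_sum (fun c' _ => sq_nonneg ‖t a b c'‖) (Finset.mem_univ c)

/-- A tensor of norm at most one lies in the closed unit ball of the sup norm. [folklore] -/
theorem norm_le_one_of_tensorNormSq_le_one {t : ι → κ → μ → ℂ} (ht : tensorNormSq t ≤ 1) :
    ‖t‖ ≤ 1 := by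
  refine (pi_norm_le_iff_of_nonneg zero_le_one).2 fun a => (pi_norm_le_iff_of_nonneg zero_le_one).2
    fun b => (pi_norm_le_iff_of_nonneg zero_le_one).2 fun c => ?_
  have h := (norm_sq_le_tensorNormSq t a b c).trans ht
  nlinarith [norm_nonneg (t a b c)]

variable [DecidableEq ι] [DecidableEq κ] [DecidableEq μ]

/-- `⟨t | (E_{pq} ⊗ 1 ⊗ 1) t⟩ = (|t⟩⟨t|₁)_{qp}`. [folklore] -/
theorem inner_actTensor_single_fst (p q : ι) (t : ι → κ → μ → ℂ) :
    ∑ a, ∑ b, ∑ c, star (t a b c) *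
      actTensor (Matrix.single p q (1 : ℂ)) (1 : Matrix κ κ ℂ) (1 : Matrix μ μ ℂ) t a b c =
      reducedDensity₁ t q p := by
  simp only [actTensor_single_fst_apply, mul_ite, mul_zero, reducedDensity₁_apply]
  rw [Finset.sum_eq_single p]
  · simp only [if_true]
    exact Finset.sum_congr rfl fun _ _ => Finset.sum_congr rfl fun _ _ => mul_comm _ _
  · intro a _ ha
    simp [Ne.symm ha]
  · simp

/-- `⟨t | (1 ⊗ E_{pq} ⊗ 1) t⟩ = (|t⟩⟨t|₂)_{qp}`. [folklore] -/
theorem inner_actTensor_single_snd (p q : κ) (t : ι → κ → μ → ℂ) :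
    ∑ a, ∑ b, ∑ c, star (t a b c) *
      actTensor (1 : Matrix ι ι ℂ) (Matrix.single p q (1 : ℂ)) (1 : Matrix μ μ ℂ) t a b c =
      reducedDensity₂ t q p := by
  simp only [actTensor_single_snd_apply, mul_ite, mul_zero, reducedDensity₂_apply]
  have hswap : ∑ a, ∑ b, ∑ c, (if p = b then star (t a b c) * t a q c else 0) =
      ∑ b, ∑ a, ∑ c, (if p = b then star (t a b c) * t a q c else 0) := Finset.sum_comm
  rw [hswap, Finset.sum_eq_single p]
  · simp only [if_true]
    exact Finset.sum_congr rfl fun _ _ => Finset.sum_congr rfl fun _ _ => mul_comm _ _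
  · intro b _ hb
    simp [Ne.symm hb]
  · simp

/-- `⟨t | (1 ⊗ 1 ⊗ E_{pq}) t⟩ = (|t⟩⟨t|₃)_{qp}`. [folklore] -/
theorem inner_actTensor_single_thd (p q : μ) (t : ι → κ → μ → ℂ) :
    ∑ a, ∑ b, ∑ c, star (t a b c) *
      actTensor (1 : Matrix ι ι ℂ) (1 : Matrix κ κ ℂ) (Matrix.single p q (1 : ℂ)) t a b c =
      reducedDensity₃ t q p := by
  simp only [actTensor_single_thd_apply, mul_ite, mul_zero, reducedDensity₃_apply]
  have hswap : ∑ a, ∑ b, ∑ c, (if p = c then star (t a b c) * t a b q else 0) =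
      ∑ c, ∑ a, ∑ b, (if p = c then star (t a b c) * t a b q else 0) :=
    calc ∑ a, ∑ b, ∑ c, (if p = c then star (t a b c) * t a b q else 0)
        = ∑ a, ∑ c, ∑ b, (if p = c then star (t a b c) * t a b q else 0) :=
          Finset.sum_congr rfl fun _ _ => Finset.sum_comm
      _ = ∑ c, ∑ a, ∑ b, (if p = c then star (t a b c) * t a b q else 0) := Finset.sum_comm
  rw [hswap, Finset.sum_eq_single p]
  · simp only [if_true]
    exact Finset.sum_congr rfl fun _ _ => Finset.sum_congr rfl fun _ _ => mul_comm _ _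
  · intro c _ hc
    simp [Ne.symm hc]
  · simp

/-- `⟨(E_{pq} ⊗ 1 ⊗ 1) t | (E_{pq} ⊗ 1 ⊗ 1) t⟩ = Re (|t⟩⟨t|₁)_{qq}`. [folklore] -/
theorem tensorNormSq_actTensor_single_fst (p q : ι) (t : ι → κ → μ → ℂ) :
    tensorNormSq (actTensor (Matrix.single p q (1 : ℂ)) (1 : Matrix κ κ ℂ) (1 : Matrix μ μ ℂ) t) =
      (reducedDensity₁ t q q).re := by
  simp only [tensorNormSq, actTensor_single_fst_apply, reducedDensity₁_apply, Complex.re_sum]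
  rw [Finset.sum_eq_single p]
  · simp only [if_true]
    refine Finset.sum_congr rfl fun _ _ => Finset.sum_congr rfl fun _ _ => ?_
    rw [Complex.star_def, Complex.mul_conj, Complex.ofReal_re, Complex.normSq_eq_norm_sq]
  · intro a _ ha
    simp [Ne.symm ha]
  · simp

/-- `⟨(1 ⊗ E_{pq} ⊗ 1) t | (1 ⊗ E_{pq} ⊗ 1) t⟩ = Re (|t⟩⟨t|₂)_{qq}`. [folklore] -/
theorem tensorNormSq_actTensor_single_snd (p q : κ) (t : ι → κ → μ → ℂ) :
    tensorNormSq (actTensor (1 : Matrix ι ι ℂ) (Matrix.single p q (1 : ℂ)) (1 : Matrix μ μ ℂ) t) =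
      (reducedDensity₂ t q q).re := by
  simp only [tensorNormSq, actTensor_single_snd_apply, reducedDensity₂_apply, Complex.re_sum]
  have hswap : ∑ a, ∑ b, ∑ c, ‖(if p = b then t a q c else 0)‖ ^ 2 =
      ∑ b, ∑ a, ∑ c, ‖(if p = b then t a q c else 0)‖ ^ 2 := Finset.sum_comm
  rw [hswap, Finset.sum_eq_single p]
  · simp only [if_true]
    refine Finset.sum_congr rfl fun _ _ => Finset.sum_congr rfl fun _ _ => ?_
    rw [Complex.star_def, Complex.mul_conj, Complex.ofReal_re, Complex.normSq_eq_norm_sq]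
  · intro b _ hb
    simp [Ne.symm hb]
  · simp

/-- `⟨(1 ⊗ 1 ⊗ E_{pq}) t | (1 ⊗ 1 ⊗ E_{pq}) t⟩ = Re (|t⟩⟨t|₃)_{qq}`. [folklore] -/
theorem tensorNormSq_actTensor_single_thd (p q : μ) (t : ι → κ → μ → ℂ) :
    tensorNormSq (actTensor (1 : Matrix ι ι ℂ) (1 : Matrix κ κ ℂ) (Matrix.single p q (1 : ℂ)) t) =
      (reducedDensity₃ t q q).re := by
  simp only [tensorNormSq, actTensor_single_thd_apply, reducedDensity₃_apply, Complex.re_sum]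
  have hswap : ∑ a, ∑ b, ∑ c, ‖(if p = c then t a b q else 0)‖ ^ 2 =
      ∑ c, ∑ a, ∑ b, ‖(if p = c then t a b q else 0)‖ ^ 2 :=
    calc ∑ a, ∑ b, ∑ c, ‖(if p = c then t a b q else 0)‖ ^ 2
        = ∑ a, ∑ c, ∑ b, ‖(if p = c then t a b q else 0)‖ ^ 2 :=
          Finset.sum_congr rfl fun _ _ => Finset.sum_comm
      _ = ∑ c, ∑ a, ∑ b, ‖(if p = c then t a b q else 0)‖ ^ 2 := Finset.sum_comm
  rw [hswap, Finset.sum_eq_single p]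
  · simp only [if_true]
    refine Finset.sum_congr rfl fun _ _ => Finset.sum_congr rfl fun _ _ => ?_
    rw [Complex.star_def, Complex.mul_conj, Complex.ofReal_re, Complex.normSq_eq_norm_sq]
  · intro c _ hc
    simp [Ne.symm hc]
  · simp

end Norms

/-! ## Lower-triangular matrices and elementary one-parameter subgroups -/

section Lower

variable {σ : Type*} [Fintype σ] [LinearOrder σ]

/-- A lower-triangular matrix with nonzero diagonal is invertible. [folklore] -/
theorem isUnit_of_blockTriangular_toDual {A : Matrix σ σ ℂ}
    (hA : A.BlockTriangular OrderDual.toDual) (hd : ∀ i, A i i ≠ 0) : IsUnit A := by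
  rw [Matrix.isUnit_iff_isUnit_det, Matrix.det_of_lowerTriangular A hA, isUnit_iff_ne_zero,
    Finset.prod_ne_zero_iff]
  exact fun i _ => hd i

omit [Fintype σ] in
/-- `1 + z E_{pq}` is lower triangular for `q ≤ p`. [folklore] -/
theorem blockTriangular_one_add_smul_single {p q : σ} (hqp : q ≤ p) (z : ℂ) :
    (1 + z • Matrix.single p q (1 : ℂ)).BlockTriangular OrderDual.toDual := by
  intro i j hij
  have hij' : i < j := OrderDual.toDual_lt_toDual.1 hij
  rw [Matrix.add_apply, Matrix.smul_apply, Matrix.one_apply_ne (ne_of_lt hij'), Matrix.single_apply,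
    if_neg, smul_zero, add_zero]
  rintro ⟨rfl, rfl⟩
  exact absurd hqp (not_le.2 hij')

omit [Fintype σ] in
/-- Diagonal entries of `1 + z E_{pq}`. [folklore] -/
theorem one_add_smul_single_apply_diag (p q i : σ) (z : ℂ) :
    (1 + z • Matrix.single p q (1 : ℂ)) i i = if p = i ∧ q = i then 1 + z else 1 := by
  rw [Matrix.add_apply, Matrix.smul_apply, Matrix.one_apply_eq, Matrix.single_apply]
  split_ifs <;> simp

/-- The weight of `1 + z E_{pq}`: `∏ᵢ (1 + z E_{pq})_{ii}^{lᵢ}` is `(1 + z)^{l_p}` if `p = q` and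
`1` otherwise. [folklore] -/
theorem prod_one_add_smul_single_diag_pow (p q : σ) (z : ℂ) (l : σ → ℕ) :
    ∏ i, (1 + z • Matrix.single p q (1 : ℂ)) i i ^ l i = if p = q then (1 + z) ^ l p else 1 := by
  simp only [one_add_smul_single_apply_diag]
  by_cases hpq : p = q
  · subst hpq
    rw [if_pos rfl, Finset.prod_eq_single p]
    · simp
    · intro i _ hi
      rw [if_neg, one_pow]
      rintro ⟨h, -⟩
      exact hi h.symm
    · intro h
      exact absurd (Finset.mem_univ p) h
  · rw [if_neg hpq]
    refine Finset.prod_eq_one fun i _ => ?_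
    rw [if_neg, one_pow]
    rintro ⟨rfl, rfl⟩
    exact hpq rfl

omit [Fintype σ] in
/-- The diagonal entries of `1 + z E_{pq}` are nonzero when `1 + z ≠ 0`. [folklore] -/
theorem one_add_smul_single_apply_diag_ne_zero (p q i : σ) {z : ℂ} (hz : 1 + z ≠ 0) :
    (1 + z • Matrix.single p q (1 : ℂ)) i i ≠ 0 := by
  rw [one_add_smul_single_apply_diag]
  split_ifs
  · exact hz
  · exact one_ne_zero

omit [Fintype σ] in
/-- A scalar matrix is lower triangular. [folklore] -/
theorem blockTriangular_smul_one (c : ℂ) :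
    (c • (1 : Matrix σ σ ℂ)).BlockTriangular OrderDual.toDual := by
  intro i j hij
  have hij' : i < j := OrderDual.toDual_lt_toDual.1 hij
  rw [Matrix.smul_apply, Matrix.one_apply_ne (ne_of_lt hij'), smul_zero]

omit [Fintype σ] in
/-- **From first-order inequalities to a diagonal matrix.** If a Hermitian matrix `ρ` satisfies,
for all `q ≤ p` and all `z` with `1 + z ≠ 0`, the inequality
`|[p = q](1 + z)^{l_p}|² ≤ (1 + 2 Re(z ρ_{qp}) + |z|² Re ρ_{qq})^k` (`[p ≠ q] := 1`), then
`ρ = diag(l/k)`: testing `z = t` and `z = it` for small real `t` and comparing first-order terms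
(`natCast_eq_mul_of_pow_le_pow_nhds`) gives `Re ρ_{qp} = Im ρ_{qp} = 0` for `q < p` and
`k ρ_{pp} = l_p`. This is the linear-algebra core of the Ness–Mumford computation. [folklore] -/
theorem eq_diagonal_of_weight_ineq {ρ : Matrix σ σ ℂ} (hρ : ρ.IsHermitian) {l : σ → ℕ} {k : ℕ}
    (hk : 0 < k)
    (H : ∀ p q, q ≤ p → ∀ z : ℂ, 1 + z ≠ 0 →
      ‖(if p = q then (1 + z) ^ l p else 1 : ℂ)‖ ^ 2 ≤
        (1 + 2 * (z * ρ q p).re + ‖z‖ ^ 2 * (ρ q q).re) ^ k) :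
    ρ = Matrix.diagonal fun i => (((l i : ℝ) / k : ℝ) : ℂ) := by
  have hk0 : (k : ℝ) ≠ 0 := Nat.cast_ne_zero.2 hk.ne'
  -- real `t` near `0` has `-1 < t`, hence `1 + t ≠ 0` in `ℂ`
  have hev : ∀ᶠ t : ℝ in 𝓝 0, -1 < t := eventually_gt_nhds (by norm_num)
  have h1t : ∀ t : ℝ, -1 < t → (1 : ℂ) + (t : ℂ) ≠ 0 := by
    intro t ht h
    have := congr_arg Complex.re h
    simp at this
    linarith
  have hIt : ∀ t : ℝ, (1 : ℂ) + Complex.I * (t : ℂ) ≠ 0 := by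
    intro t h
    have := congr_arg Complex.re h
    simp at this
  -- diagonal entries
  have hdiag : ∀ p, (l p : ℝ) = k * (ρ p p).re := by
    intro p
    refine natCast_eq_mul_of_pow_le_pow_nhds (b := (ρ p p).re) ?_
    filter_upwards [hev] with t ht
    have h := H p p le_rfl t (h1t t ht)
    rw [if_pos rfl, norm_pow, ← pow_mul] at h
    have h1 : ‖(1 : ℂ) + t‖ = 1 + t := by
      rw [show (1 : ℂ) + t = ((1 + t : ℝ) : ℂ) by push_cast; rfl, Complex.norm_real,
        Real.norm_eq_abs, abs_of_pos (by linarith)]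
    rw [h1, Complex.re_ofReal_mul, Complex.norm_real, Real.norm_eq_abs, sq_abs, mul_comm (l p) 2]
      at h
    convert h using 2
    ring
  -- off-diagonal entries, real part
  have hre : ∀ p q, q < p → (ρ q p).re = 0 := by
    intro p q hqp
    have h0 : ((0 : ℕ) : ℝ) = k * (ρ q p).re := by
      refine natCast_eq_mul_of_pow_le_pow_nhds (b := (ρ q q).re) ?_
      filter_upwards [hev] with t ht
      have h := H p q hqp.le t (h1t t ht)
      rw [if_neg (ne_of_gt hqp), norm_one, one_pow, Complex.re_ofReal_mul, Complex.norm_real,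
        Real.norm_eq_abs, sq_abs] at h
      rw [mul_zero, pow_zero]
      convert h using 2
      ring
    rw [Nat.cast_zero] at h0
    exact (mul_eq_zero.1 h0.symm).resolve_left hk0
  -- off-diagonal entries, imaginary part
  have him : ∀ p q, q < p → (ρ q p).im = 0 := by
    intro p q hqp
    have h0 : ((0 : ℕ) : ℝ) = k * (-(ρ q p).im) := by
      refine natCast_eq_mul_of_pow_le_pow_nhds (b := (ρ q q).re) ?_
      filter_upwards [hev] with t ht
      have h := H p q hqp.le (Complex.I * t) (hIt t)
      rw [if_neg (ne_of_gt hqp), norm_one, one_pow, norm_mul, Complex.norm_I, one_mul,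
        Complex.norm_real, Real.norm_eq_abs, sq_abs, mul_assoc, Complex.I_mul_re,
        Complex.im_ofReal_mul] at h
      rw [mul_zero, pow_zero]
      convert h using 2
      ring
    rw [Nat.cast_zero] at h0
    have := (mul_eq_zero.1 h0.symm).resolve_left hk0
    linarith
  -- assemble
  ext i j
  rw [Matrix.diagonal_apply]
  by_cases hij : i = j
  · subst hij
    rw [if_pos rfl]
    apply Complex.ext
    · rw [Complex.ofReal_re, eq_div_iff hk0, mul_comm]
      exact (hdiag i).symm
    · rw [Complex.ofReal_im]
      exact Complex.conj_eq_iff_im.1 (by simpa using hρ.apply i i)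
  · rw [if_neg hij]
    rcases lt_or_gt_of_ne hij with h | h
    · exact Complex.ext (by rw [hre j i h, Complex.zero_re]) (by rw [him j i h, Complex.zero_im])
    · rw [← hρ.apply i j]
      have : ρ j i = 0 :=
        Complex.ext (by rw [hre i j h, Complex.zero_re]) (by rw [him i j h, Complex.zero_im])
      rw [this, star_zero]

end Lower

/-! ## Semi-invariants of the lower-triangular Borel subgroup and the Ness–Mumford argument -/

section SemiInvariant

variable {ι κ μ : Type*} [Fintype ι] [Fintype κ] [Fintype μ] [LinearOrder ι] [LinearOrder κ]
  [LinearOrder μ]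

/-- A function `f` on the tensor space `ℂ^ι ⊗ ℂ^κ ⊗ ℂ^μ` is a **semi-invariant of weight
`(l, m, n)` for the lower-triangular Borel subgroup** `B⁻(ι) × B⁻(κ) × B⁻(μ) ≤ GL × GL × GL` if
`f((A ⊗ B ⊗ C)·x) = (∏ᵢ A_{ii}^{lᵢ}) (∏ⱼ B_{jj}^{mⱼ}) (∏_c C_{cc}^{n_c}) · f(x)` for all lower
triangular `A, B, C` with nonzero diagonal entries and all `x`. For a homogeneous polynomial `f`
of degree `d` this says that `f` is a highest-weight vector of weight `(l, m, n)` (necessarily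
`|l| = |m| = |n| = d`) for the representation `(g·f)(x) = f(gᵀ·x)` of `GL × GL × GL` on
polynomials, with respect to the upper-triangular Borel subgroups (the convention of
`Literature.NumberTheory.DiophantineGeometry.highestWeightSpace`); such `f` are the
highest-weight "covariants" of classical invariant theory (Ness–Mumford; Brion; in the language of
CVZ §3.4 they detect the normalised highest weights `(l, m, n)/d` of the entanglement polytope,
see `IsLowerSemiInvariant.exists_degeneratesTo_reducedDensity_eq_diagonal`).
[folklore] -/
def IsLowerSemiInvariant (f : (ι → κ → μ → ℂ) → ℂ) (l : ι → ℕ) (m : κ → ℕ) (n : μ → ℕ) : Prop :=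
  ∀ (A : Matrix ι ι ℂ) (B : Matrix κ κ ℂ) (C : Matrix μ μ ℂ),
    A.BlockTriangular OrderDual.toDual → B.BlockTriangular OrderDual.toDual →
    C.BlockTriangular OrderDual.toDual →
    (∀ i, A i i ≠ 0) → (∀ j, B j j ≠ 0) → (∀ c, C c c ≠ 0) →
    ∀ x, f (actTensor A B C x) = (∏ i, A i i ^ l i) * (∏ j, B j j ^ m j) * (∏ c, C c c ^ n c) * f x

namespace IsLowerSemiInvariant

variable {f : (ι → κ → μ → ℂ) → ℂ} {l : ι → ℕ} {m : κ → ℕ} {n : μ → ℕ}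

/-- Unfolding of `IsLowerSemiInvariant`. [folklore] -/
theorem apply_actTensor (hf : IsLowerSemiInvariant f l m n) {A : Matrix ι ι ℂ} {B : Matrix κ κ ℂ}
    {C : Matrix μ μ ℂ} (hA : A.BlockTriangular OrderDual.toDual)
    (hB : B.BlockTriangular OrderDual.toDual) (hC : C.BlockTriangular OrderDual.toDual)
    (hAd : ∀ i, A i i ≠ 0) (hBd : ∀ j, B j j ≠ 0) (hCd : ∀ c, C c c ≠ 0) (x : ι → κ → μ → ℂ) :
    f (actTensor A B C x) = (∏ i, A i i ^ l i) * (∏ j, B j j ^ m j) * (∏ c, C c c ^ n c) * f x :=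
  hf A B C hA hB hC hAd hBd hCd x

/-- A semi-invariant of weight `(l, m, n)` is homogeneous of degree `|l| = ∑ lᵢ` (scalars
`c·1 ⊗ 1 ⊗ 1` lie in the Borel subgroup). [folklore] -/
theorem apply_smul (hf : IsLowerSemiInvariant f l m n) {c : ℂ} (hc : c ≠ 0) (x : ι → κ → μ → ℂ) :
    f (c • x) = c ^ (∑ i, l i) * f x := by
  have h := hf.apply_actTensor (blockTriangular_smul_one c) Matrix.blockTriangular_one
    Matrix.blockTriangular_one (fun i => by simpa using hc) (fun j => by simp) (fun c => by simp) x
  rw [actTensor_smul_one] at h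
  rw [h]
  simp [Finset.prod_pow_eq_pow_sum]

/-- A nonzero semi-invariant of positive degree does not vanish only at nonzero tensors.
[folklore] -/
theorem ne_zero_of_apply_ne_zero (hf : IsLowerSemiInvariant f l m n) (hk : 0 < ∑ i, l i)
    {x : ι → κ → μ → ℂ} (hx : f x ≠ 0) : x ≠ 0 := by
  rintro rfl
  apply hx
  have h := hf.apply_smul (two_ne_zero : (2 : ℂ) ≠ 0) 0
  rw [smul_zero] at h
  have h2 : (2 : ℂ) ^ (∑ i, l i) ≠ 1 := by
    rw [show (2 : ℂ) = ((2 : ℝ) : ℂ) by norm_num, ← Complex.ofReal_pow, Ne, Complex.ofReal_eq_one]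
    exact ne_of_gt (one_lt_pow₀ one_lt_two hk.ne')
  have : ((2 : ℂ) ^ (∑ i, l i) - 1) * f 0 = 0 := by rw [sub_mul, one_mul, ← h, sub_self]
  exact (mul_eq_zero.1 this).resolve_left (sub_ne_zero.2 h2)

omit [LinearOrder ι] [LinearOrder κ] [LinearOrder μ] in
/-- Normalising a nonzero tensor: `‖x‖⁻¹ x` has norm one. [folklore] -/
theorem tensorNormSq_normalize {x : ι → κ → μ → ℂ} (hx : x ≠ 0) :
    tensorNormSq ((((Real.sqrt (tensorNormSq x))⁻¹ : ℝ) : ℂ) • x) = 1 := by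
  have hN := tensorNormSq_pos hx
  rw [tensorNormSq_smul, Complex.norm_real, Real.norm_eq_abs, sq_abs, inv_pow,
    Real.sq_sqrt hN.le, inv_mul_cancel₀ hN.ne']

/-- Nonzero scalar multiples stay in the orbit closure. [folklore] -/
theorem _root_.Literature.Computability.AlgebraicComplexity.TensorDegeneratesTo.smul
    {x y : ι → κ → μ → ℂ} (h : TensorDegeneratesTo x y) {c : ℂ} (hc : c ≠ 0) :
    TensorDegeneratesTo x (c • y) := by
  have hu : IsUnit (c • (1 : Matrix ι ι ℂ)) :=
    isUnit_of_blockTriangular_toDual (blockTriangular_smul_one c) fun i => by simpa using hc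
  have h' := h.actTensor_right (hu.unit, 1, 1)
  simpa only [IsUnit.unit_spec, Units.val_one, actTensor_smul_one] using h'

/-- **Existence of an extremal vector.** For a continuous semi-invariant `f` of positive degree
`d = |l|` with `f(x) ≠ 0` there is a unit vector `u` in the orbit closure of `x` maximising `|f|²`
on the unit sphere of the orbit closure; by homogeneity this gives
`|f(g·u)|² ≤ |f(u)|² ‖g·u‖^{2d}` for every `g ∈ GL × GL × GL`, and `f(u) ≠ 0`.
(Ness–Mumford: the function `|f|²/‖·‖^{2d}` attains its supremum on the orbit closure.)
[folklore] -/
theorem exists_extremal (hf : IsLowerSemiInvariant f l m n) (hfc : Continuous f)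
    (hk : 0 < ∑ i, l i) {x : ι → κ → μ → ℂ} (hx : f x ≠ 0) :
    ∃ u, TensorDegeneratesTo x u ∧ tensorNormSq u = 1 ∧ f u ≠ 0 ∧
      ∀ g : GL ι ℂ × GL κ ℂ × GL μ ℂ,
        ‖f (actTensor (g.1 : Matrix ι ι ℂ) (g.2.1 : Matrix κ κ ℂ) (g.2.2 : Matrix μ μ ℂ) u)‖ ^ 2 ≤
          ‖f u‖ ^ 2 * tensorNormSq (actTensor (g.1 : Matrix ι ι ℂ) (g.2.1 : Matrix κ κ ℂ)
            (g.2.2 : Matrix μ μ ℂ) u) ^ (∑ i, l i) := by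
  set k := ∑ i, l i with hk_def
  have hx0 : x ≠ 0 := hf.ne_zero_of_apply_ne_zero hk hx
  set S : Set (ι → κ → μ → ℂ) := {u | TensorDegeneratesTo x u} ∩ {u | tensorNormSq u = 1} with hS
  -- normalisation
  have hinv : ∀ y : ι → κ → μ → ℂ, y ≠ 0 → (((Real.sqrt (tensorNormSq y))⁻¹ : ℝ) : ℂ) ≠ 0 := by
    intro y hy
    exact_mod_cast (inv_pos.2 (Real.sqrt_pos.2 (tensorNormSq_pos hy))).ne'
  have hmemS : ∀ y : ι → κ → μ → ℂ, y ≠ 0 → TensorDegeneratesTo x y →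
      (((Real.sqrt (tensorNormSq y))⁻¹ : ℝ) : ℂ) • y ∈ S := fun y hy hxy =>
    ⟨hxy.smul (hinv y hy), tensorNormSq_normalize hy⟩
  -- compactness
  have hSc : IsCompact S := by
    refine (isCompact_closedBall (0 : ι → κ → μ → ℂ) 1).of_isClosed_subset ?_ ?_
    · exact isClosed_closure.inter (isClosed_eq continuous_tensorNormSq continuous_const)
    · rintro u ⟨-, hu⟩
      exact mem_closedBall_zero_iff.2 (norm_le_one_of_tensorNormSq_le_one (le_of_eq hu))
  have hSn : S.Nonempty := ⟨_, hmemS x hx0 (TensorDegeneratesTo.refl x)⟩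
  have hφ : Continuous fun u : ι → κ → μ → ℂ => ‖f u‖ ^ 2 := hfc.norm.pow 2
  obtain ⟨u, ⟨hxu, hu1⟩, humax⟩ := hSc.exists_isMaxOn hSn hφ.continuousOn
  rw [Set.mem_setOf_eq] at hxu hu1
  have hu0 : u ≠ 0 := by
    rintro rfl
    rw [(tensorNormSq_eq_zero_iff _).2 rfl] at hu1
    exact zero_ne_one hu1
  -- `f u ≠ 0`
  have hfu : f u ≠ 0 := by
    have h : ‖f ((((Real.sqrt (tensorNormSq x))⁻¹ : ℝ) : ℂ) • x)‖ ^ 2 ≤ ‖f u‖ ^ 2 :=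
      humax (hmemS x hx0 (TensorDegeneratesTo.refl x))
    rw [hf.apply_smul (hinv x hx0), norm_mul, mul_pow] at h
    intro hfu0
    rw [hfu0, norm_zero, zero_pow two_ne_zero] at h
    have hpos : 0 < ‖(((Real.sqrt (tensorNormSq x))⁻¹ : ℝ) : ℂ) ^ k‖ ^ 2 * ‖f x‖ ^ 2 :=
      mul_pos (pow_pos (norm_pos_iff.2 (pow_ne_zero _ (hinv x hx0))) 2)
        (pow_pos (norm_pos_iff.2 hx) 2)
    exact absurd h (not_le.2 hpos)
  refine ⟨u, hxu, hu1, hfu, fun g => ?_⟩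
  set y := actTensor (g.1 : Matrix ι ι ℂ) (g.2.1 : Matrix κ κ ℂ) (g.2.2 : Matrix μ μ ℂ) u with hy
  have hy0 : y ≠ 0 := actTensor_ne_zero_of_ne_zero hu0 g
  have hNy : 0 < tensorNormSq y := tensorNormSq_pos hy0
  set c : ℝ := (Real.sqrt (tensorNormSq y))⁻¹ with hc
  have hcpos : 0 < c := inv_pos.2 (Real.sqrt_pos.2 hNy)
  have h : ‖f (((c : ℝ) : ℂ) • y)‖ ^ 2 ≤ ‖f u‖ ^ 2 := humax (hmemS y hy0 (hxu.actTensor_right g))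
  rw [hf.apply_smul (hinv y hy0), norm_mul, mul_pow, norm_pow, Complex.norm_real,
    Real.norm_eq_abs, abs_of_pos hcpos, ← pow_mul, mul_comm k 2, pow_mul, hc, inv_pow,
    Real.sq_sqrt hNy.le] at h
  -- h : (tensorNormSq y)⁻¹ ^ k * ‖f y‖ ^ 2 ≤ ‖f u‖ ^ 2
  calc ‖f y‖ ^ 2 = tensorNormSq y ^ k * ((tensorNormSq y)⁻¹ ^ k * ‖f y‖ ^ 2) := by
        rw [← mul_assoc, ← mul_pow, mul_inv_cancel₀ hNy.ne', one_pow, one_mul]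
    _ ≤ tensorNormSq y ^ k * ‖f u‖ ^ 2 := mul_le_mul_of_nonneg_left h (pow_nonneg hNy.le k)
    _ = ‖f u‖ ^ 2 * tensorNormSq y ^ k := mul_comm _ _

/-- The first-order inequalities at an extremal vector, first factor: testing
`g = (1 + z E_{pq}) ⊗ 1 ⊗ 1` (`q ≤ p`, lower triangular). [folklore] -/
theorem weight_ineq₁ (hf : IsLowerSemiInvariant f l m n) {u : ι → κ → μ → ℂ}
    (hu1 : tensorNormSq u = 1) (hfu : f u ≠ 0)
    (hkey : ∀ g : GL ι ℂ × GL κ ℂ × GL μ ℂ,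
      ‖f (actTensor (g.1 : Matrix ι ι ℂ) (g.2.1 : Matrix κ κ ℂ) (g.2.2 : Matrix μ μ ℂ) u)‖ ^ 2 ≤
        ‖f u‖ ^ 2 * tensorNormSq (actTensor (g.1 : Matrix ι ι ℂ) (g.2.1 : Matrix κ κ ℂ)
          (g.2.2 : Matrix μ μ ℂ) u) ^ (∑ i, l i))
    (p q : ι) (hqp : q ≤ p) (z : ℂ) (hz : 1 + z ≠ 0) :
    ‖(if p = q then (1 + z) ^ l p else 1 : ℂ)‖ ^ 2 ≤
      (1 + 2 * (z * reducedDensity₁ u q p).re + ‖z‖ ^ 2 * (reducedDensity₁ u q q).re) ^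
        (∑ i, l i) := by
  set A : Matrix ι ι ℂ := 1 + z • Matrix.single p q (1 : ℂ) with hA_def
  have hA : A.BlockTriangular OrderDual.toDual := blockTriangular_one_add_smul_single hqp z
  have hAd : ∀ i, A i i ≠ 0 := fun i => one_add_smul_single_apply_diag_ne_zero p q i hz
  have hAu : IsUnit A := isUnit_of_blockTriangular_toDual hA hAd
  have h := hkey (hAu.unit, 1, 1)
  simp only [IsUnit.unit_spec, Units.val_one] at h
  rw [hf.apply_actTensor hA Matrix.blockTriangular_one Matrix.blockTriangular_one hAd
    (fun j => by simp) (fun c => by simp) u] at h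
  have hnrm : tensorNormSq (actTensor A (1 : Matrix κ κ ℂ) (1 : Matrix μ μ ℂ) u) =
      1 + 2 * (z * reducedDensity₁ u q p).re + ‖z‖ ^ 2 * (reducedDensity₁ u q q).re := by
    rw [hA_def, actTensor_one_add_smul_fst, tensorNormSq_add_smul, inner_actTensor_single_fst,
      tensorNormSq_actTensor_single_fst, hu1]
  rw [hnrm, hA_def, prod_one_add_smul_single_diag_pow] at h
  simp only [Matrix.one_apply_eq, one_pow, Finset.prod_const_one, mul_one, norm_mul, mul_pow] at h
  have hpos : 0 < ‖f u‖ ^ 2 := pow_pos (norm_pos_iff.2 hfu) 2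
  rw [mul_comm] at h
  exact le_of_mul_le_mul_left h hpos

/-- The first-order inequalities at an extremal vector, second factor. [folklore] -/
theorem weight_ineq₂ (hf : IsLowerSemiInvariant f l m n) {u : ι → κ → μ → ℂ}
    (hu1 : tensorNormSq u = 1) (hfu : f u ≠ 0)
    (hkey : ∀ g : GL ι ℂ × GL κ ℂ × GL μ ℂ,
      ‖f (actTensor (g.1 : Matrix ι ι ℂ) (g.2.1 : Matrix κ κ ℂ) (g.2.2 : Matrix μ μ ℂ) u)‖ ^ 2 ≤
        ‖f u‖ ^ 2 * tensorNormSq (actTensor (g.1 : Matrix ι ι ℂ) (g.2.1 : Matrix κ κ ℂ)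
          (g.2.2 : Matrix μ μ ℂ) u) ^ (∑ i, l i))
    (p q : κ) (hqp : q ≤ p) (z : ℂ) (hz : 1 + z ≠ 0) :
    ‖(if p = q then (1 + z) ^ m p else 1 : ℂ)‖ ^ 2 ≤
      (1 + 2 * (z * reducedDensity₂ u q p).re + ‖z‖ ^ 2 * (reducedDensity₂ u q q).re) ^
        (∑ i, l i) := by
  set B : Matrix κ κ ℂ := 1 + z • Matrix.single p q (1 : ℂ) with hB_def
  have hB : B.BlockTriangular OrderDual.toDual := blockTriangular_one_add_smul_single hqp z
  have hBd : ∀ j, B j j ≠ 0 := fun j => one_add_smul_single_apply_diag_ne_zero p q j hz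
  have hBu : IsUnit B := isUnit_of_blockTriangular_toDual hB hBd
  have h := hkey (1, hBu.unit, 1)
  simp only [IsUnit.unit_spec, Units.val_one] at h
  rw [hf.apply_actTensor Matrix.blockTriangular_one hB Matrix.blockTriangular_one (fun i => by simp)
    hBd (fun c => by simp) u] at h
  have hnrm : tensorNormSq (actTensor (1 : Matrix ι ι ℂ) B (1 : Matrix μ μ ℂ) u) =
      1 + 2 * (z * reducedDensity₂ u q p).re + ‖z‖ ^ 2 * (reducedDensity₂ u q q).re := by
    rw [hB_def, actTensor_one_add_smul_snd, tensorNormSq_add_smul, inner_actTensor_single_snd,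
      tensorNormSq_actTensor_single_snd, hu1]
  rw [hnrm, hB_def, prod_one_add_smul_single_diag_pow] at h
  simp only [Matrix.one_apply_eq, one_pow, Finset.prod_const_one, mul_one, one_mul, norm_mul,
    mul_pow] at h
  have hpos : 0 < ‖f u‖ ^ 2 := pow_pos (norm_pos_iff.2 hfu) 2
  rw [mul_comm] at h
  exact le_of_mul_le_mul_left h hpos

/-- The first-order inequalities at an extremal vector, third factor. [folklore] -/
theorem weight_ineq₃ (hf : IsLowerSemiInvariant f l m n) {u : ι → κ → μ → ℂ}
    (hu1 : tensorNormSq u = 1) (hfu : f u ≠ 0)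
    (hkey : ∀ g : GL ι ℂ × GL κ ℂ × GL μ ℂ,
      ‖f (actTensor (g.1 : Matrix ι ι ℂ) (g.2.1 : Matrix κ κ ℂ) (g.2.2 : Matrix μ μ ℂ) u)‖ ^ 2 ≤
        ‖f u‖ ^ 2 * tensorNormSq (actTensor (g.1 : Matrix ι ι ℂ) (g.2.1 : Matrix κ κ ℂ)
          (g.2.2 : Matrix μ μ ℂ) u) ^ (∑ i, l i))
    (p q : μ) (hqp : q ≤ p) (z : ℂ) (hz : 1 + z ≠ 0) :
    ‖(if p = q then (1 + z) ^ n p else 1 : ℂ)‖ ^ 2 ≤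
      (1 + 2 * (z * reducedDensity₃ u q p).re + ‖z‖ ^ 2 * (reducedDensity₃ u q q).re) ^
        (∑ i, l i) := by
  set C : Matrix μ μ ℂ := 1 + z • Matrix.single p q (1 : ℂ) with hC_def
  have hC : C.BlockTriangular OrderDual.toDual := blockTriangular_one_add_smul_single hqp z
  have hCd : ∀ c, C c c ≠ 0 := fun c => one_add_smul_single_apply_diag_ne_zero p q c hz
  have hCu : IsUnit C := isUnit_of_blockTriangular_toDual hC hCd
  have h := hkey (1, 1, hCu.unit)
  simp only [IsUnit.unit_spec, Units.val_one] at h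
  rw [hf.apply_actTensor Matrix.blockTriangular_one Matrix.blockTriangular_one hC (fun i => by simp)
    (fun j => by simp) hCd u] at h
  have hnrm : tensorNormSq (actTensor (1 : Matrix ι ι ℂ) (1 : Matrix κ κ ℂ) C u) =
      1 + 2 * (z * reducedDensity₃ u q p).re + ‖z‖ ^ 2 * (reducedDensity₃ u q q).re := by
    rw [hC_def, actTensor_one_add_smul_thd, tensorNormSq_add_smul, inner_actTensor_single_thd,
      tensorNormSq_actTensor_single_thd, hu1]
  rw [hnrm, hC_def, prod_one_add_smul_single_diag_pow] at h
  simp only [Matrix.one_apply_eq, one_pow, Finset.prod_const_one, mul_one, one_mul, norm_mul,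
    mul_pow] at h
  have hpos : 0 < ‖f u‖ ^ 2 := pow_pos (norm_pos_iff.2 hfu) 2
  rw [mul_comm] at h
  exact le_of_mul_le_mul_left h hpos

/-- **Spectra from semi-invariants (Ness–Mumford for 3-tensors).** Let `f` be a continuous
semi-invariant of weight `(l, m, n)` for the lower-triangular Borel subgroup of `GL × GL × GL`,
of positive degree `d = |l|`, and let `f(x) ≠ 0`. Then the orbit closure of `x` contains a unit
vector `u` whose three one-particle reduced density matrices are *diagonal with diagonals*
`l/d`, `m/d`, `n/d`: `u` is a maximiser of `|f|²` on the unit sphere of the orbit closure, and the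
vanishing of the first variation along the one-parameter subgroups `1 + z E_{pq}` of the three
Borel subgroups (`eq_diagonal_of_weight_ineq`) forces the off-diagonal entries of the marginals to
vanish and the diagonal ones to equal the normalised weight. In particular `|m| = |n| = d` as
well. This is the classical Ness–Mumford / Kempf–Ness computation of the moment map at a critical
point of a highest-weight covariant, specialised to tensors; it is the mechanism behind the
inclusion "normalised highest weights of non-vanishing covariants lie in the entanglement
(moment) polytope" (CVZ Thm. 3.29, due to Ness–Mumford, Brion, Walter–Doran–Gross–Christandl).
[folklore] -/
theorem exists_degeneratesTo_reducedDensity_eq_diagonal (hf : IsLowerSemiInvariant f l m n)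
    (hfc : Continuous f) (hk : 0 < ∑ i, l i) {x : ι → κ → μ → ℂ} (hx : f x ≠ 0) :
    ∃ u, TensorDegeneratesTo x u ∧ tensorNormSq u = 1 ∧
      reducedDensity₁ u = Matrix.diagonal (fun i => (((l i : ℝ) / (∑ i, l i : ℕ) : ℝ) : ℂ)) ∧
      reducedDensity₂ u = Matrix.diagonal (fun j => (((m j : ℝ) / (∑ i, l i : ℕ) : ℝ) : ℂ)) ∧
      reducedDensity₃ u = Matrix.diagonal (fun c => (((n c : ℝ) / (∑ i, l i : ℕ) : ℝ) : ℂ)) := by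
  obtain ⟨u, hxu, hu1, hfu, hkey⟩ := hf.exists_extremal hfc hk hx
  exact ⟨u, hxu, hu1,
    eq_diagonal_of_weight_ineq (isHermitian_reducedDensity₁ u) hk (hf.weight_ineq₁ hu1 hfu hkey),
    eq_diagonal_of_weight_ineq (isHermitian_reducedDensity₂ u) hk (hf.weight_ineq₂ hu1 hfu hkey),
    eq_diagonal_of_weight_ineq (isHermitian_reducedDensity₃ u) hk (hf.weight_ineq₃ hu1 hfu hkey)⟩

end IsLowerSemiInvariant

end SemiInvariant

/-! ## Consequence for the quantum functional: `E_θ(x) ≥ H_θ` of the normalised weight -/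

section Entropy

variable {σ : Type*} [Fintype σ] [DecidableEq σ]

/-- Symmetric functions of the eigenvalues of a real diagonal matrix are the same functions of the
diagonal entries (the spectrum of `diag(d)` is the multiset of the `dᵢ`). [folklore] -/
theorem sum_map_eigenvalues_of_eq_diagonal {M : Matrix σ σ ℂ} (hM : M.IsHermitian) (d : σ → ℝ)
    (h : M = Matrix.diagonal fun i => (d i : ℂ)) {γ : Type*} [AddCommMonoid γ] (F : ℝ → γ) :
    ∑ i, F (hM.eigenvalues i) = ∑ i, F (d i) := by
  have hr1 : M.charpoly.roots =
      (Finset.univ : Finset σ).val.map fun i => (hM.eigenvalues i : ℂ) := by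
    rw [hM.charpoly_eq, roots_prod_X_sub_C_eq_map]
    rfl
  have hr2 : M.charpoly.roots = (Finset.univ : Finset σ).val.map fun i => (d i : ℂ) := by
    rw [h, Matrix.charpoly_diagonal, roots_prod_X_sub_C_eq_map]
  have hr : (Finset.univ : Finset σ).val.map (fun i => hM.eigenvalues i) =
      (Finset.univ : Finset σ).val.map d := by
    have h' := congr_arg (Multiset.map Complex.re) (hr1.symm.trans hr2)
    simpa only [Multiset.map_map, Function.comp_def, Complex.ofReal_re] using h'
  calc ∑ i, F (hM.eigenvalues i)
      = (((Finset.univ : Finset σ).val.map fun i => hM.eigenvalues i).map F).sum := by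
        rw [Finset.sum_eq_multiset_sum, Multiset.map_map]
        rfl
    _ = (((Finset.univ : Finset σ).val.map d).map F).sum := by rw [hr]
    _ = ∑ i, F (d i) := by
        rw [Finset.sum_eq_multiset_sum, Multiset.map_map]
        rfl

variable {ι κ μ : Type*} [Fintype ι] [Fintype κ] [Fintype μ] [DecidableEq ι] [DecidableEq κ]
  [DecidableEq μ]

omit [DecidableEq κ] [DecidableEq μ] in
/-- If `|u⟩⟨u|₁ = diag(d)` for a unit vector `u` then `H(r₁(u)) = H(d)`. [folklore] -/
theorem shannonEntropy_marginalSpectrum₁_of_eq_diagonal {u : ι → κ → μ → ℂ}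
    (hu1 : tensorNormSq u = 1) (d : ι → ℝ)
    (h : reducedDensity₁ u = Matrix.diagonal fun i => (d i : ℂ)) :
    shannonEntropy (marginalSpectrum₁ u) = shannonEntropy d := by
  rw [shannonEntropy_def, shannonEntropy_def]
  congr 1
  simp only [marginalSpectrum₁, hu1, div_one]
  exact sum_map_eigenvalues_of_eq_diagonal (isHermitian_reducedDensity₁ u) d h Real.negMulLog

omit [DecidableEq ι] [DecidableEq μ] in
/-- If `|u⟩⟨u|₂ = diag(d)` for a unit vector `u` then `H(r₂(u)) = H(d)`. [folklore] -/
theorem shannonEntropy_marginalSpectrum₂_of_eq_diagonal {u : ι → κ → μ → ℂ}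
    (hu1 : tensorNormSq u = 1) (d : κ → ℝ)
    (h : reducedDensity₂ u = Matrix.diagonal fun j => (d j : ℂ)) :
    shannonEntropy (marginalSpectrum₂ u) = shannonEntropy d := by
  rw [shannonEntropy_def, shannonEntropy_def]
  congr 1
  simp only [marginalSpectrum₂, hu1, div_one]
  exact sum_map_eigenvalues_of_eq_diagonal (isHermitian_reducedDensity₂ u) d h Real.negMulLog

omit [DecidableEq ι] [DecidableEq κ] in
/-- If `|u⟩⟨u|₃ = diag(d)` for a unit vector `u` then `H(r₃(u)) = H(d)`. [folklore] -/
theorem shannonEntropy_marginalSpectrum₃_of_eq_diagonal {u : ι → κ → μ → ℂ}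
    (hu1 : tensorNormSq u = 1) (d : μ → ℝ)
    (h : reducedDensity₃ u = Matrix.diagonal fun c => (d c : ℂ)) :
    shannonEntropy (marginalSpectrum₃ u) = shannonEntropy d := by
  rw [shannonEntropy_def, shannonEntropy_def]
  congr 1
  simp only [marginalSpectrum₃, hu1, div_one]
  exact sum_map_eigenvalues_of_eq_diagonal (isHermitian_reducedDensity₃ u) d h Real.negMulLog

/-- **`E_θ` is invariant under the group**: `E_θ((A ⊗ B ⊗ C)·x) = E_θ(x)` for invertible
`A, B, C` and `θ ≥ 0` (both tensors degenerate to each other).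
[cite: ChristandlVranaZuiddam2023, Lemma 3.20] -/
theorem logQuantumFunctional_actTensor_gl {θ : Fin 3 → ℝ} (hθ : ∀ i, 0 ≤ θ i)
    (x : ι → κ → μ → ℂ) (g : GL ι ℂ × GL κ ℂ × GL μ ℂ) :
    logQuantumFunctional θ
        (actTensor (g.1 : Matrix ι ι ℂ) (g.2.1 : Matrix κ κ ℂ) (g.2.2 : Matrix μ μ ℂ) x) =
      logQuantumFunctional θ x := by
  by_cases hx : x = 0
  · subst hx
    rw [actTensor_zero]
  refine le_antisymm
    (logQuantumFunctional_le_of_degeneratesTo hθ (actTensor_ne_zero_of_ne_zero hx g)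
      (TensorDegeneratesTo.of_gl x g))
    (logQuantumFunctional_le_of_degeneratesTo hθ hx ?_)
  have hback : actTensor ((g⁻¹).1 : Matrix ι ι ℂ) ((g⁻¹).2.1 : Matrix κ κ ℂ)
      ((g⁻¹).2.2 : Matrix μ μ ℂ)
      (actTensor (g.1 : Matrix ι ι ℂ) (g.2.1 : Matrix κ κ ℂ) (g.2.2 : Matrix μ μ ℂ) x) = x := by
    rw [actTensor_actTensor, Prod.fst_inv, Prod.snd_inv, Prod.fst_inv, Prod.snd_inv, Units.inv_mul,
      Units.inv_mul, Units.inv_mul, actTensor_one]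
  have h := TensorDegeneratesTo.of_gl
    (actTensor (g.1 : Matrix ι ι ℂ) (g.2.1 : Matrix κ κ ℂ) (g.2.2 : Matrix μ μ ℂ) x) g⁻¹
  rwa [hback] at h

end Entropy

section EntropyBound

variable {ι κ μ : Type*} [Fintype ι] [Fintype κ] [Fintype μ] [LinearOrder ι] [LinearOrder κ]
  [LinearOrder μ]
variable {f : (ι → κ → μ → ℂ) → ℂ} {l : ι → ℕ} {m : κ → ℕ} {n : μ → ℕ}

/-- **The quantum functional dominates the entropy of the normalised weight of a non-vanishing
semi-invariant.** If a continuous semi-invariant `f` of weight `(l, m, n)` and positive degree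
`d = |l|` does not vanish at `x`, then for every `θ ≥ 0`
`E_θ(x) ≥ θ₁ H(l/d) + θ₂ H(m/d) + θ₃ H(n/d)`: the orbit closure of `x` contains a unit vector `u`
with `H_θ(u)` equal to the right-hand side (`exists_degeneratesTo_reducedDensity_eq_diagonal`), and
`H_θ ≤ E_θ(x)` on the orbit closure (CVZ Lemma 3.20). For the weights `(λ, μ, ν)/n` of the
highest-weight covariants of degree `n` this is the inequality `E^θ(x) ≤ E_θ(x)` of CVZ Thm. 3.30
(the direction of Cor. 3.31 used for sub-multiplicativity).
[cite: ChristandlVranaZuiddam2023, Thm. 3.30] -/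
theorem IsLowerSemiInvariant.weightedEntropy_le_logQuantumFunctional
    (hf : IsLowerSemiInvariant f l m n) (hfc : Continuous f) (hk : 0 < ∑ i, l i)
    {x : ι → κ → μ → ℂ} (hx : f x ≠ 0) {θ : Fin 3 → ℝ} (hθ : ∀ i, 0 ≤ θ i) :
    θ 0 * shannonEntropy (fun i => (l i : ℝ) / (∑ i, l i : ℕ)) +
        θ 1 * shannonEntropy (fun j => (m j : ℝ) / (∑ i, l i : ℕ)) +
        θ 2 * shannonEntropy (fun c => (n c : ℝ) / (∑ i, l i : ℕ)) ≤
      logQuantumFunctional θ x := by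
  obtain ⟨u, hxu, hu1, h₁, h₂, h₃⟩ := hf.exists_degeneratesTo_reducedDensity_eq_diagonal hfc hk hx
  have hu0 : u ≠ 0 := by
    rintro rfl
    rw [(tensorNormSq_eq_zero_iff _).2 rfl] at hu1
    exact zero_ne_one hu1
  have hH : quantumEntropy θ u = θ 0 * shannonEntropy (fun i => (l i : ℝ) / (∑ i, l i : ℕ)) +
      θ 1 * shannonEntropy (fun j => (m j : ℝ) / (∑ i, l i : ℕ)) +
      θ 2 * shannonEntropy (fun c => (n c : ℝ) / (∑ i, l i : ℕ)) := by
    rw [quantumEntropy, shannonEntropy_marginalSpectrum₁_of_eq_diagonal hu1 _ h₁,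
      shannonEntropy_marginalSpectrum₂_of_eq_diagonal hu1 _ h₂,
      shannonEntropy_marginalSpectrum₃_of_eq_diagonal hu1 _ h₃]
  rw [← hH]
  exact quantumEntropy_le_logQuantumFunctional_of_degeneratesTo hθ hu0 hxu

/-- The same bound when `f` is only known not to vanish somewhere on the orbit of `x`
(`E_θ` is constant on orbits). [cite: ChristandlVranaZuiddam2023, Thm. 3.30] -/
theorem IsLowerSemiInvariant.weightedEntropy_le_logQuantumFunctional_of_orbit
    (hf : IsLowerSemiInvariant f l m n) (hfc : Continuous f) (hk : 0 < ∑ i, l i)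
    {x : ι → κ → μ → ℂ} (g : GL ι ℂ × GL κ ℂ × GL μ ℂ)
    (hx : f (actTensor (g.1 : Matrix ι ι ℂ) (g.2.1 : Matrix κ κ ℂ) (g.2.2 : Matrix μ μ ℂ) x) ≠ 0)
    {θ : Fin 3 → ℝ} (hθ : ∀ i, 0 ≤ θ i) :
    θ 0 * shannonEntropy (fun i => (l i : ℝ) / (∑ i, l i : ℕ)) +
        θ 1 * shannonEntropy (fun j => (m j : ℝ) / (∑ i, l i : ℕ)) +
        θ 2 * shannonEntropy (fun c => (n c : ℝ) / (∑ i, l i : ℕ)) ≤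
      logQuantumFunctional θ x := by
  rw [← logQuantumFunctional_actTensor_gl hθ x g]
  exact hf.weightedEntropy_le_logQuantumFunctional hfc hk hx hθ

end EntropyBound

end Literature.Computability.AlgebraicComplexity

end
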